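import Literature.RepresentationTheory.MoeglinVignerasWaldspurger1987.RankOneOscillatorMultiplicityOne
import Literature.RepresentationTheory.HeisenbergGroup.SchrodingerLeraySectionGram
import Literature.RepresentationTheory.HeisenbergGroup.SchrodingerCommutantPi
import Literature.NumberTheory.Automorphic.UnitaryGroupLocalCenterScalar
import Literature.NumberTheory.Automorphic.UnitaryGroupNonsplitTorus
import Literature.NumberTheory.Weil1964.LocalWeilIndex
import Literature.NumberTheory.Weil1964.LocalGaussIntegralSeveralVariables
import Literature.NumberTheory.Weil1964.LocalQuadraticGaussIntegralCoefficient
import Literature.RepresentationTheory.HeisenbergGroup.SchrodingerBigCellWordScalar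
import Literature.NumberTheory.Automorphic.LocalFieldHaarBalls
import HarnessLib

/-!
# The rank `1 × 1` oscillator representation on Weil's big cell: the torus-side package (H1 of the c3 character route)

Topic `RepresentationTheory/MoeglinVignerasWaldspurger1987`; namespace
`Literature.RepresentationTheory.MoeglinVignerasWaldspurger1987`.  THEOREMS ONLY (no definition, no named fact, no
`sorry`).  Cell `hodgecm-mathlib`, fan B, row IV-4(c3) `rankOne_theta_twist_rigidity` via the CHARACTER ROUTE
(director g2 BATCH 12; B-p04's carve 2026-08-28T05:45:53Z; H2 = `HeisenbergGroup.trace_restrict_fixed_eq_of_bigCell_family`,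
`SchrodingerBigCellTrace.lean`; TR = `rankOne_torusTrace_ne_zero`; assembly `nonPeriodic₁₁_of_torusTrace`).

THE MATHEMATICS.  Let `E/F` be quadratic, `v` a finite place of `F` NON-SPLIT in `E`, `J₁ = t ⊗ 1` a hermitian line,
`ω = ω_{s₁}` the Weil representation of `U(J₁)(F_v) = E_v¹` on `𝒮(F_v)` through a smooth splitting `s₁` over `ι_v`.
Write the scalar of `g ∈ U(J₁)(F_v)` as `ζ_g = a + b δ` (`a, b ∈ F_v`, `a² - d b² = 1`).  Then `ι_v(g)` acts on
`𝕎_v = F_v × F_v` by `(p, q) ↦ (a p + d b q, b p + a q)` (§1) and its conjugate by `e = gramProd 𝕋_v` has Weil blocks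
`A = D = a`, `B = d b τ⁻¹`, `C = τ b` (`𝕋_v = (τ)`, §2); so `g` is in WEIL'S BIG CELL iff `b ≠ 0` iff `g² ≠ 1`, and
there `ω(g) = λ_g · r(n(γ)) r(m(B)) r(w) r(n(δ'))` with `γ = δ' = a/β`, `β = d b τ⁻¹`, for a scalar `λ_g` (§3–§4:
`bigCellOp_mem_MpPsi`, transport along `e`, uniqueness of implementers up to scalars; the diagonal of the kernel of the
word is the second-degree character of `β⁻¹(1 - a) x²`).  For `z₀` with `z₀² ≠ 1` the coordinates of `z₀ k` vary
continuously with `k`; on a small OPEN SUBGROUP `K₀` (the torus is profinite) `|b|`, `|β⁻¹(1 - a)|` are constant,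
`β_k⁻¹(1 - a_k)` stays in one congruence class, `𝟙_{𝔭^{n₁}}` is fixed, and reading `ω(z₀ k) 𝟙_{𝔭^{n₁}}` at `0`
shows that `λ_{z₀k} |det B_k|^{-1/2}` is ONE constant `c ≠ 0` (`exists_const_word`); the Gauss integrals of the
diagonal phase over all deep boxes are ONE Weil stable value `Gv ≠ 0` (`gaussBall_eq_weilGauss_of_sub_mem_of_lt`,
`weilGauss_ne_zero`), and the cells shift boxes by a uniform `e₀` — the hypotheses (W1)–(W3) of H2.
MAIN: **`rankOne_torus_bigCell_package`** (§7).  HC_CM is NOT proved here; HC_CM is proved only modulo the 7 printed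
citations until rung 0 of the ladder closes.

## References
* [Weil1964] A. Weil, Sur certains groupes d'opérateurs unitaires, Acta Math. 111 (1964): n° 6–7 pp. 151–152 (cells),
  n° 13 (29) p. 160 (the operators `r(s)` on the big cell), Chap. II n° 27 p. 175 (stable Gauss integrals).
* [MoeglinVignerasWaldspurger1987] C. Mœglin, M.-F. Vignéras, J.-L. Waldspurger, LNM 1291 (1987), Chap. 2 II.1 (A)
  (implementers unique up to scalars), Ch. 1 I.17 (unitary groups in symplectic groups).
* [Rangarao1993] R. Ranga Rao, Pacific J. Math. 157 (1993), Lemma 3.2, (3.8)–(3.9) p. 351.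
* [Mok2014] C. P. Mok, Mem. AMS 235 (2015), §1 Notation p. 5 (the norm-one torus `U(1)`).
* [PlatonovRapinchuk1994] V. Platonov, A. Rapinchuk, *Algebraic Groups and Number Theory*, §6.2 (compact tori).
-/

set_option autoImplicit false

noncomputable section

open NumberField IsDedekindDomain Matrix MeasureTheory
open scoped Matrix MatrixGroups NNReal Topology
open Literature.RepresentationTheory Literature.RepresentationTheory.HeisenbergGroup
open Literature.NumberTheory.GelbartRogawski1991.UnitaryDualPair.LocalSplitting
open Literature.NumberTheory.Automorphic Literature.NumberTheory.Automorphic.UnitaryGroup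
open Literature.NumberTheory.Automorphic.Liu2021
open Literature.NumberTheory.GaloisRepresentations.IsNonarchimedeanLocalField
open Literature.NumberTheory.Weil1964

namespace Literature.RepresentationTheory.MoeglinVignerasWaldspurger1987

/-! ## §1 Coordinates of `U(J₁)(F_v) = E_v¹` and the matrix of `ι_v(g)` on `𝕎_v = F_v × F_v` -/

section Coordinates

variable {F : Type} [Field F] [NumberField F] (E : Type) [Field E] [NumberField E] [Algebra F E]
  (c : E ≃ₐ[F] E) (J₁ : Matrix (Fin 1) (Fin 1) E) (v : HeightOneSpectrum (𝓞 F))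

/-- **the scalar of `g ∈ U(J₁)(F_v)`**: the `1 × 1` matrix `localPiEquiv g ∈ GL_1(E_v)` acts on `E_v^1` by its entry
`ζ_g = (g_w)₀₀`, and `ζ_g · ζ_gᶜ = 1` (the unitary relation for the line `J₁ = (j)`, `j ≠ 0`).
[cite: Mok2014, §1 Notation p. 5] -/
theorem rankOne_mulVec_eq_smul_and_norm (hJ₁ : J₁ 0 0 ≠ 0) (g : localPi E c 1 J₁ v) :
    (∀ x : Fin 1 → LocalRing E v,
        ((localPiEquiv E c 1 J₁ v g : «local» E c 1 J₁ v) : GL (Fin 1) (LocalRing E v)).val *ᵥ x =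
          (fun w : PlacesOver E v => ((g : LocalGLPi E 1 v) w).val 0 0) • x) ∧
      (fun w : PlacesOver E v => ((g : LocalGLPi E 1 v) w).val 0 0) *
        conjLocal E c v (fun w : PlacesOver E v => ((g : LocalGLPi E 1 v) w).val 0 0) = 1 := by
  set g' : GL (Fin 1) (LocalRing E v) := ((localPiEquiv E c 1 J₁ v g : «local» E c 1 J₁ v) : GL (Fin 1) (LocalRing E v))
    with hg'
  set ζ : LocalRing E v := fun w : PlacesOver E v => ((g : LocalGLPi E 1 v) w).val 0 0 with hζ
  have h00 : g'.val 0 0 = ζ := by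
    funext w
    rw [hg', coe_localPiEquiv_apply, GLn.coe_piEquiv_symm_apply]
  have hmat : g'.val = ζ • (1 : Matrix (Fin 1) (Fin 1) (LocalRing E v)) := by
    ext i j
    obtain rfl : i = 0 := Subsingleton.elim _ _
    obtain rfl : j = 0 := Subsingleton.elim _ _
    rw [Matrix.smul_apply, Matrix.one_apply_eq, smul_eq_mul, mul_one, h00]
  refine ⟨fun x => ?_, ?_⟩
  · rw [hmat, Matrix.smul_mulVec, Matrix.one_mulVec]
  · -- the unitary relation at the entry `(0, 0)`
    have hmem : (g'.val.map (conjLocal E c v))ᵀ * J₁.map (algebraMap E (LocalRing E v)) * g'.val =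
        J₁.map (algebraMap E (LocalRing E v)) := by
      have h : g' ∈ unitaryGroupOfForm (conjLocal E c v) ((adelicForm E 1 J₁).map (adeleToLocal E v)) :=
        (localPiEquiv E c 1 J₁ v g).2
      rw [mem_unitaryGroupOfForm_iff, LemD1OfPlace.localGram_eq] at h
      exact h
    have h := congrFun (congrFun hmem 0) 0
    simp only [Matrix.mul_apply, Fin.sum_univ_one, Matrix.transpose_apply, Matrix.map_apply, h00] at h
    have hj : IsUnit (algebraMap E (LocalRing E v) (J₁ 0 0)) := hJ₁.isUnit.map _
    refine hj.mul_right_cancel ?_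
    rw [one_mul, mul_assoc, mul_comm ζ]
    exact h

/-- **`ι_v(g)` on `𝕎_v = F_v × F_v` (rank `1`)**: in the coordinates `reIm` of `E_v = F_v ⊕ F_v δ`, `ι_v(g)` is
multiplication by the scalar `ζ_g = a + b δ` of `g`, i.e. `(p, q) ↦ (a p + d b q, a q + b p)`.
[cite: MoeglinVignerasWaldspurger1987, Ch. 1 I.17] -/
theorem rankOne_iota_apply [Algebra.IsQuadraticExtension F E] {δ : E} (hcδ : c δ = -δ) (hδ : δ ≠ 0) {d : F}
    (hd : δ * δ = algebraMap F E d) (t : Matrix (Fin 1) (Fin 1) F) (ht : t.IsSymm) (hJ₁ : J₁ = t.map (algebraMap F E))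
    (hJ₁' : J₁ 0 0 ≠ 0) (g : localPi E c 1 J₁ v) (p q : Fin 1 → v.adicCompletion F) :
    (iota F E c 1 hcδ hδ hd t ht hJ₁ v g).1 (p, q) =
      (fun i => QuadraticCoordinates.re (quadraticLocalEquiv E v c hcδ hδ).toLinearEquiv.toAddEquiv
            (fun w : PlacesOver E v => ((g : LocalGLPi E 1 v) w).val 0 0) * p i +
          (d : v.adicCompletion F) *
            (QuadraticCoordinates.im (quadraticLocalEquiv E v c hcδ hδ).toLinearEquiv.toAddEquiv
              (fun w : PlacesOver E v => ((g : LocalGLPi E 1 v) w).val 0 0) * q i),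
        fun i => QuadraticCoordinates.re (quadraticLocalEquiv E v c hcδ hδ).toLinearEquiv.toAddEquiv
            (fun w : PlacesOver E v => ((g : LocalGLPi E 1 v) w).val 0 0) * q i +
          QuadraticCoordinates.im (quadraticLocalEquiv E v c hcδ hδ).toLinearEquiv.toAddEquiv
            (fun w : PlacesOver E v => ((g : LocalGLPi E 1 v) w).val 0 0) * p i) := by
  have hq := isQuadraticCoordinates_local E v c hcδ hδ hd
  set Ψ := (quadraticLocalEquiv E v c hcδ hδ).toLinearEquiv.toAddEquiv with hΨ
  set ζ : LocalRing E v := fun w : PlacesOver E v => ((g : LocalGLPi E 1 v) w).val 0 0 with hζ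
  set x : Fin 1 → LocalRing E v := (QuadraticCoordinates.reIm Ψ (Fin 1)).symm (p, q) with hx
  have hx' : QuadraticCoordinates.reIm Ψ (Fin 1) x = (p, q) := AddEquiv.apply_symm_apply _ _
  rw [← hx', iota_def]
  change (localToSymplectic E c 1 v hcδ hδ hd ht hJ₁ (localPiEquiv E c 1 J₁ v g)).1 _ = _
  rw [localToSymplectic_reIm, (rankOne_mulVec_eq_smul_and_norm E c J₁ v hJ₁' g).1 x]
  refine Prod.ext (funext fun i => ?_) (funext fun i => ?_)
  · rw [QuadraticCoordinates.reIm_apply_fst, Pi.smul_apply, smul_eq_mul, hq.re_mul, hx,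
      QuadraticCoordinates.reIm_symm_apply, QuadraticCoordinates.re_apply, QuadraticCoordinates.im_apply]
  · rw [QuadraticCoordinates.reIm_apply_snd, Pi.smul_apply, smul_eq_mul, hq.im_mul, hx,
      QuadraticCoordinates.reIm_symm_apply, QuadraticCoordinates.re_apply, QuadraticCoordinates.im_apply]

/-- the scalar map `g ↦ ζ_g ∈ E_v` is multiplicative. [cite: Mok2014, §1 Notation p. 5] -/
theorem rankOne_scalar_mul (g h : localPi E c 1 J₁ v) :
    (fun w : PlacesOver E v => (((g * h : localPi E c 1 J₁ v) : LocalGLPi E 1 v) w).val 0 0 : LocalRing E v) =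
      (fun w : PlacesOver E v => ((g : LocalGLPi E 1 v) w).val 0 0) *
        fun w : PlacesOver E v => ((h : LocalGLPi E 1 v) w).val 0 0 := by
  funext w
  change (((g : LocalGLPi E 1 v) w * (h : LocalGLPi E 1 v) w : GL (Fin 1) (w.1.adicCompletion E))).val 0 0 = _
  rw [Units.val_mul, Matrix.mul_apply, Fin.sum_univ_one]
  rfl

/-- the scalar map `g ↦ ζ_g ∈ E_v = Π_{w ∣ v} E_w` is continuous. [cite: PlatonovRapinchuk1994, §6.2] -/
theorem rankOne_continuous_scalar :
    Continuous fun g : localPi E c 1 J₁ v =>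
      (fun w : PlacesOver E v => ((g : LocalGLPi E 1 v) w).val 0 0 : LocalRing E v) :=
  continuous_pi fun w => continuous_entry c J₁ w

/-- **the norm-one relation in coordinates**: `a² - d b² = 1` for `ζ_g = a + b δ`. [cite: Mok2014, §1 Notation p. 5] -/
theorem rankOne_re_sq_sub (hJ₁ : J₁ 0 0 ≠ 0) [Algebra.IsQuadraticExtension F E] {δ : E} (hcδ : c δ = -δ)
    (hδ : δ ≠ 0) {d : F} (hd : δ * δ = algebraMap F E d) (g : localPi E c 1 J₁ v) :
    QuadraticCoordinates.re (quadraticLocalEquiv E v c hcδ hδ).toLinearEquiv.toAddEquiv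
          (fun w : PlacesOver E v => ((g : LocalGLPi E 1 v) w).val 0 0) ^ 2 -
        (d : v.adicCompletion F) *
          QuadraticCoordinates.im (quadraticLocalEquiv E v c hcδ hδ).toLinearEquiv.toAddEquiv
            (fun w : PlacesOver E v => ((g : LocalGLPi E 1 v) w).val 0 0) ^ 2 = 1 := by
  have hq := isQuadraticCoordinates_local E v c hcδ hδ hd
  set Ψ := (quadraticLocalEquiv E v c hcδ hδ).toLinearEquiv.toAddEquiv with hΨ
  set ζ : LocalRing E v := fun w : PlacesOver E v => ((g : LocalGLPi E 1 v) w).val 0 0 with hζ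
  have hnorm := (rankOne_mulVec_eq_smul_and_norm E c J₁ v hJ₁ g).2
  change ζ * conjLocal E c v ζ = 1 at hnorm
  set a := QuadraticCoordinates.re Ψ ζ with ha
  set b := QuadraticCoordinates.im Ψ ζ with hb
  have hζe : ζ = toLocalRing E v a + toLocalRing E v b * algebraMap E (LocalRing E v) δ := (hq.re_add_im ζ).symm
  have hcδ' : conjLocal E c v (algebraMap E (LocalRing E v) δ) = -algebraMap E (LocalRing E v) δ := by
    rw [conjLocal_algebraMap, hcδ, map_neg]
  have hconj : conjLocal E c v ζ = toLocalRing E v a - toLocalRing E v b * algebraMap E (LocalRing E v) δ := by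
    conv_lhs => rw [hζe]
    rw [map_add, map_mul, conjLocal_toLocalRing, conjLocal_toLocalRing, hcδ', mul_neg, sub_eq_add_neg]
  have hprod : toLocalRing E v (a ^ 2 - (d : v.adicCompletion F) * b ^ 2) = 1 := by
    rw [← hnorm, hconj]
    conv_rhs => rw [hζe]
    have hδδ : algebraMap E (LocalRing E v) δ * algebraMap E (LocalRing E v) δ =
        toLocalRing E v (d : v.adicCompletion F) := hq.mul_self
    rw [map_sub, map_mul, map_pow, map_pow]
    linear_combination (toLocalRing E v b) ^ 2 * hδδ
  have h := congrArg (QuadraticCoordinates.re Ψ) hprod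
  rwa [hq.re_map, hq.re_one] at h

/-- `ζ_{g²} = ζ_g²`-consequence: if the `δ`-coordinate of `ζ_g` vanishes then `g² = 1` (so `g² ≠ 1 ⇒ b ≠ 0`, Weil's
big cell). [cite: Weil1964, n° 7, p. 152] -/
theorem rankOne_im_ne_zero_of_mul_self_ne_one (hJ₁ : J₁ 0 0 ≠ 0) [Algebra.IsQuadraticExtension F E] {δ : E}
    (hcδ : c δ = -δ) (hδ : δ ≠ 0) {d : F} (hd : δ * δ = algebraMap F E d) (g : localPi E c 1 J₁ v)
    (hg : g * g ≠ 1) :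
    QuadraticCoordinates.im (quadraticLocalEquiv E v c hcδ hδ).toLinearEquiv.toAddEquiv
      (fun w : PlacesOver E v => ((g : LocalGLPi E 1 v) w).val 0 0) ≠ 0 := by
  have hq := isQuadraticCoordinates_local E v c hcδ hδ hd
  set Ψ := (quadraticLocalEquiv E v c hcδ hδ).toLinearEquiv.toAddEquiv with hΨ
  set ζ : LocalRing E v := fun w : PlacesOver E v => ((g : LocalGLPi E 1 v) w).val 0 0 with hζ
  intro hb
  apply hg
  have hnorm := (rankOne_mulVec_eq_smul_and_norm E c J₁ v hJ₁ g).2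
  change ζ * conjLocal E c v ζ = 1 at hnorm
  have hζe : ζ = toLocalRing E v (QuadraticCoordinates.re Ψ ζ) := by
    have := (hq.re_add_im ζ).symm
    rwa [hb, map_zero, zero_mul, add_zero] at this
  have hconjζ : conjLocal E c v ζ = ζ := by rw [hζe, conjLocal_toLocalRing]
  have hζζ : ζ * ζ = 1 := by
    calc ζ * ζ = ζ * conjLocal E c v ζ := by rw [hconjζ]
      _ = 1 := hnorm
  -- read on the entries: `(g²)_w = ζ_w² = 1`
  have hsq := rankOne_scalar_mul E c J₁ v g g
  change (fun w : PlacesOver E v => (((g * g : localPi E c 1 J₁ v) : LocalGLPi E 1 v) w).val 0 0) = ζ * ζ at hsq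
  rw [hζζ] at hsq
  refine Subtype.ext (funext fun w => Units.ext (Matrix.ext fun i j => ?_))
  obtain rfl : i = 0 := Subsingleton.elim _ _
  obtain rfl : j = 0 := Subsingleton.elim _ _
  have hw := congrFun hsq w
  simp only [Pi.one_apply] at hw
  change (((g * g : localPi E c 1 J₁ v) : LocalGLPi E 1 v) w).val 0 0 = ((1 : LocalGLPi E 1 v) w).val 0 0
  rw [hw, Pi.one_apply, Units.val_one, Matrix.one_apply_eq]


end Coordinates

/-! ## §2 The `gramProd`-conjugate of `ι_v(g)` in `Sp(F_v × F_v, ⟨·,·⟩)`: blocks `A = D = a`, `B = d b τ⁻¹`, `C = τ b` -/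

section Conj

variable {F : Type} [Field F] [NumberField F] (E : Type) [Field E] [NumberField E] [Algebra F E]
  [Algebra.IsQuadraticExtension F E] (c : E ≃ₐ[F] E) {δ : E} (hcδ : c δ = -δ) (hδ : δ ≠ 0) {d : F}
  (hd : δ * δ = algebraMap F E d) (t : Matrix (Fin 1) (Fin 1) F) (ht : t.IsSymm) (htd : IsUnit t.det)
  {J₁ : Matrix (Fin 1) (Fin 1) E} (hJ₁ : J₁ = t.map (algebraMap F E)) (v : HeightOneSpectrum (𝓞 F))

omit [NumberField F] in
/-- a `1 × 1` matrix acts on `R^1` by its entry. [folklore] -/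
private theorem mulVec_fin_one {R : Type*} [CommRing R] (M : Matrix (Fin 1) (Fin 1) R) (z : Fin 1 → R) :
    M *ᵥ z = M 0 0 • z := by
  funext i
  obtain rfl : i = 0 := Subsingleton.elim _ _
  simp [Matrix.mulVec, dotProduct]

include htd in
omit [NumberField E] [Algebra.IsQuadraticExtension F E] in
/-- `𝕋_v = (τ)` with `τ = t₀₀ ≠ 0` (`det t` is a unit). [folklore] -/
private theorem localGram_entry_ne_zero : localGram F 1 t v 0 0 ≠ 0 := by
  have h := (UnitaryGroup.isUnit_det_map (algebraMap F (v.adicCompletion F)) htd).ne_zero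
  rwa [Matrix.det_fin_one] at h

omit [NumberField E] [Algebra.IsQuadraticExtension F E] in
/-- `β_{𝕋_v}(·, y)` is continuous. [folklore] -/
private theorem continuous_localPairing_left' (y : Fin 1 → v.adicCompletion F) :
    Continuous fun u : Fin 1 → v.adicCompletion F => Matrix.toLinearMap₂' (v.adicCompletion F) (localGram F 1 t v) u y := by
  simp only [Matrix.toLinearMap₂'_apply', dotProduct]
  exact continuous_finsetSum _ fun i _ => (continuous_apply i).mul continuous_const

/-- **the conjugate `e ι_v(g) e⁻¹`, `e = gramProd 𝕋_v : (x, y) ↦ (x, 𝕋_v y)`, on `F_v × F_v`**: with `ζ_g = a + b δ`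
and `𝕋_v = (τ)`, `(x, y) ↦ (a x + d b τ⁻¹ y, τ b x + a y)` — Weil's blocks `A = D = a`, `B = d b τ⁻¹`, `C = τ b`.
[cite: Weil1964, n° 7, p. 152; MoeglinVignerasWaldspurger1987, Ch. 1 I.17] -/
theorem rankOne_conj_iota_apply (g : localPi E c 1 J₁ v) (x y : Fin 1 → v.adicCompletion F) :
    ((symplecticConj (gramProd (localGram F 1 t v) (UnitaryGroup.isUnit_det_map (algebraMap F (v.adicCompletion F)) htd))
        (polar_dotProductBilin_gramProd (localGram F 1 t v) (UnitaryGroup.isUnit_det_map (algebraMap F (v.adicCompletion F)) htd))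
        (iota F E c 1 hcδ hδ hd t ht hJ₁ v g) :
          symplecticGroup (polar (dotProductBilin (v.adicCompletion F) (v.adicCompletion F) (m := Fin 1)))) :
        ((Fin 1 → v.adicCompletion F) × (Fin 1 → v.adicCompletion F)) ≃ₗ[v.adicCompletion F]
          ((Fin 1 → v.adicCompletion F) × (Fin 1 → v.adicCompletion F))) (x, y) =
      (fun i => QuadraticCoordinates.re (quadraticLocalEquiv E v c hcδ hδ).toLinearEquiv.toAddEquiv
            (fun w : PlacesOver E v => ((g : LocalGLPi E 1 v) w).val 0 0) * x i +
          (d : v.adicCompletion F) *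
              QuadraticCoordinates.im (quadraticLocalEquiv E v c hcδ hδ).toLinearEquiv.toAddEquiv
                (fun w : PlacesOver E v => ((g : LocalGLPi E 1 v) w).val 0 0) *
            (localGram F 1 t v 0 0)⁻¹ * y i,
        fun i => localGram F 1 t v 0 0 *
            QuadraticCoordinates.im (quadraticLocalEquiv E v c hcδ hδ).toLinearEquiv.toAddEquiv
              (fun w : PlacesOver E v => ((g : LocalGLPi E 1 v) w).val 0 0) * x i +
          QuadraticCoordinates.re (quadraticLocalEquiv E v c hcδ hδ).toLinearEquiv.toAddEquiv
            (fun w : PlacesOver E v => ((g : LocalGLPi E 1 v) w).val 0 0) * y i) := by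
  have hJ₁' : J₁ 0 0 ≠ 0 := by
    rw [hJ₁, Matrix.map_apply, map_ne_zero_iff _ (algebraMap F E).injective, ← Matrix.det_fin_one t]
    exact htd.ne_zero
  have hτ0 : localGram F 1 t v 0 0 ≠ 0 := localGram_entry_ne_zero t htd v
  have hxy : (x, y) = gramProd (localGram F 1 t v) (UnitaryGroup.isUnit_det_map (algebraMap F (v.adicCompletion F)) htd) (x, (localGram F 1 t v 0 0)⁻¹ • y) := by
    rw [gramProd_apply, mulVec_fin_one, smul_smul, mul_inv_cancel₀ hτ0, one_smul]
  rw [hxy, symplecticConj_apply, LinearEquiv.symm_apply_apply, rankOne_iota_apply E c J₁ v hcδ hδ hd t ht hJ₁ hJ₁',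
    gramProd_apply, mulVec_fin_one]
  refine Prod.ext (funext fun i => ?_) (funext fun i => ?_)
  · simp only [Pi.smul_apply, smul_eq_mul]
    ring
  · simp only [Pi.smul_apply, smul_eq_mul]
    field_simp
    ring

end Conj


/-! ## §3 The implementer identity: `ω_{s₁}(g) = λ_g · r(e ι_v(g) e⁻¹)` on Weil's big cell -/

section Implementer

variable (F : Type) [Field F] [NumberField F] (E : Type) [Field E] [NumberField E] [Algebra F E]
  [Algebra.IsQuadraticExtension F E] (c : E ≃ₐ[F] E) {δ : E} (hcδ : c δ = -δ) (hδ : δ ≠ 0) {d : F}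
  (hd : δ * δ = algebraMap F E d) (t : Matrix (Fin 1) (Fin 1) F) (ht : t.IsSymm) (htd : IsUnit t.det)
  {J₁ : Matrix (Fin 1) (Fin 1) E} (hJ₁ : J₁ = t.map (algebraMap F E)) (v : HeightOneSpectrum (𝓞 F))
  [MeasurableSpace (v.adicCompletion F)] [BorelSpace (v.adicCompletion F)]
  (μ : Measure (v.adicCompletion F)) [μ.IsAddHaarMeasure] {m : ℤ} (hm : (adeleAddCharAt F v).HasConductorExp m)
  (s₁ : localPi E c 1 J₁ v →* LocalMp F 1 t v)
  (hs₁ : ∀ g, MpPsi.proj _ (s₁ g) = iota F E c 1 hcδ hδ hd t ht hJ₁ v g)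

include hs₁ in
/-- **`ω_{s₁}(g) = λ_g · r(n(γ) m(B) w n(δ))`**: for `g ∈ U(J₁)(F_v)` whose conjugate `g' = e ι_v(g) e⁻¹`
(`e = gramProd 𝕋_v`) lies in Weil's big cell (`B`-block invertible), the operator `ω_{s₁}(g)` on `𝒮(F_v)` is a scalar
multiple of the big-cell word `r(n(D B⁻¹)) r(m(B)) r(w) r(n(B⁻¹ A))` of the DOT Schrödinger model — both implement `g'`
(transport of structure along `e`, `bigCellOp_mem_MpPsi`) and implementers are unique up to scalars (MVW II.1).
[cite: MoeglinVignerasWaldspurger1987, Chap. 2 II.1 (A); Weil1964, n° 13 (29), p. 160] -/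
theorem rankOne_exists_scalar_bigCellWord (g : localPi E c 1 J₁ v)
    (g' : symplecticGroup (polar (dotProductBilin (v.adicCompletion F) (v.adicCompletion F) (m := Fin 1))))
    (hg' : g' = symplecticConj (gramProd (localGram F 1 t v) (UnitaryGroup.isUnit_det_map (algebraMap F (v.adicCompletion F)) htd))
        (polar_dotProductBilin_gramProd (localGram F 1 t v) (UnitaryGroup.isUnit_det_map (algebraMap F (v.adicCompletion F)) htd))
        (iota F E c 1 hcδ hδ hd t ht hJ₁ v g))
    (hB : Function.Bijective (blockB (g' :
        ((Fin 1 → v.adicCompletion F) × (Fin 1 → v.adicCompletion F)) ≃ₗ[v.adicCompletion F]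
          ((Fin 1 → v.adicCompletion F) × (Fin 1 → v.adicCompletion F))))) :
    ∃ lam : ℂˣ, ∀ f : SchwartzBruhat (Fin 1 → v.adicCompletion F),
      ((MpPsi.toRep (localSchrodinger F 1 t v)).comp s₁) g f =
        (lam : ℂ) •
          ((unipOpPi (isLocallyConstant_of_isContinuousNontrivial (isContinuousNontrivial_adeleAddCharAt F v))
                (cellGamma (g' : ((Fin 1 → v.adicCompletion F) × (Fin 1 → v.adicCompletion F)) ≃ₗ[v.adicCompletion F]
                  ((Fin 1 → v.adicCompletion F) × (Fin 1 → v.adicCompletion F))) hB) *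
              leviOpPi (cellB (g' : ((Fin 1 → v.adicCompletion F) × (Fin 1 → v.adicCompletion F)) ≃ₗ[v.adicCompletion F]
                  ((Fin 1 → v.adicCompletion F) × (Fin 1 → v.adicCompletion F))) hB) *
              fourierOpPi (ι := Fin 1) μ (isContinuousNontrivial_adeleAddCharAt F v) hm *
              unipOpPi (isLocallyConstant_of_isContinuousNontrivial (isContinuousNontrivial_adeleAddCharAt F v))
                (cellDelta (g' : ((Fin 1 → v.adicCompletion F) × (Fin 1 → v.adicCompletion F)) ≃ₗ[v.adicCompletion F]
                  ((Fin 1 → v.adicCompletion F) × (Fin 1 → v.adicCompletion F))) hB) :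
            SchwartzBruhat (Fin 1 → v.adicCompletion F) ≃ₗ[ℂ] SchwartzBruhat (Fin 1 → v.adicCompletion F)) f) := by
  have hψ := isContinuousNontrivial_adeleAddCharAt F v
  have hb : ∀ y : Fin 1 → v.adicCompletion F,
      Continuous fun u : Fin 1 → v.adicCompletion F => dotProductBilin (v.adicCompletion F) (v.adicCompletion F) u y :=
    continuous_dotProductBilin_left
  have hBe := polar_dotProductBilin_gramProd (localGram F 1 t v) (UnitaryGroup.isUnit_det_map (algebraMap F (v.adicCompletion F)) htd)
  -- (1) `ω_{s₁}(g)` implements `ι(g)` for the Gram model, hence `g'` for the dot model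
  have h1 : Implements (localSchrodinger F 1 t v) (ofSymplectic _ (iota F E c 1 hcδ hδ hd t ht hJ₁ v g))
      (MpPsi.toOp _ (s₁ g)) := by
    have h := MpPsi.toRep_implements (localSchrodinger F 1 t v) (s₁ g)
    have e1 : ((s₁ g : LocalMp F 1 t v) : LocalSp F 1 t v × (SchwartzBruhat (Fin 1 → v.adicCompletion F) ≃ₗ[ℂ]
        SchwartzBruhat (Fin 1 → v.adicCompletion F))).1 = iota F E c 1 hcδ hδ hd t ht hJ₁ v g := hs₁ g
    rw [e1] at h
    exact h
  have hρ : ∀ a, localSchrodinger F 1 t v a =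
      schrodingerSB (dotProductBilin (v.adicCompletion F) (v.adicCompletion F) (m := Fin 1)) (adeleAddCharAt F v)
        (isLocallyConstant_of_isContinuousNontrivial hψ) hb
        (Heisenberg.mapEquiv (gramProd (localGram F 1 t v) (UnitaryGroup.isUnit_det_map (algebraMap F (v.adicCompletion F)) htd)) hBe a) := fun a =>
    schrodingerSB_gram_eq (localGram F 1 t v) (UnitaryGroup.isUnit_det_map (algebraMap F (v.adicCompletion F)) htd) (isLocallyConstant_of_isContinuousNontrivial hψ)
      hb (continuous_localPairing_left' t v) a
  have h2 := (implements_iff_implements_symplecticConj (gramProd (localGram F 1 t v) (UnitaryGroup.isUnit_det_map (algebraMap F (v.adicCompletion F)) htd)) hBe hρ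
    (iota F E c 1 hcδ hδ hd t ht hJ₁ v g) (MpPsi.toOp _ (s₁ g))).1 h1
  rw [← hg'] at h2
  -- (2) the big-cell word implements `g'`
  have h3 : Implements (schrodingerSB (dotProductBilin (v.adicCompletion F) (v.adicCompletion F) (m := Fin 1))
      (adeleAddCharAt F v) (isLocallyConstant_of_isContinuousNontrivial hψ) hb) (ofSymplectic _ g')
      (bigCellOp (isLocallyConstant_of_isContinuousNontrivial hψ) μ hψ hm g') := by
    have h := bigCellOp_mem_MpPsi (isLocallyConstant_of_isContinuousNontrivial hψ) hb μ hψ hm g' hB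
    rwa [mem_MpPsi] at h
  -- (3) uniqueness up to scalars
  obtain ⟨lam, hlam⟩ :=
    implementerUniqueUpToScalar_schrodingerSB_pi (isLocallyConstant_of_isContinuousNontrivial hψ) hb hψ g' _ _ h3 h2
  refine ⟨lam, fun f => ?_⟩
  rw [← bigCellOp_of_bijective (isLocallyConstant_of_isContinuousNontrivial hψ) μ hψ hm g' hB]
  exact hlam f

end Implementer


/-! ## §4 The cells of the conjugate at rank one: `B = (d b τ⁻¹)·1`, `γ = δ = (a / (d b τ⁻¹))·1`, and the diagonal phase -/

section Cells

variable {F : Type} [Field F] [NumberField F] (E : Type) [Field E] [NumberField E] [Algebra F E]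
  [Algebra.IsQuadraticExtension F E] (c : E ≃ₐ[F] E) {δ : E} (hcδ : c δ = -δ) (hδ : δ ≠ 0) {d : F}
  (hd : δ * δ = algebraMap F E d) (t : Matrix (Fin 1) (Fin 1) F) (ht : t.IsSymm) (htd : IsUnit t.det)
  {J₁ : Matrix (Fin 1) (Fin 1) E} (hJ₁ : J₁ = t.map (algebraMap F E)) (v : HeightOneSpectrum (𝓞 F))

/-- **the blocks of `g' = e ι_v(g) e⁻¹`**: `B y = (d b τ⁻¹) y`, `A x = a x`, `D y = a y`.
[cite: Weil1964, n° 7, Prop. 1, p. 152] -/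
theorem rankOne_conj_blocks (g : localPi E c 1 J₁ v)
    (g' : symplecticGroup (polar (dotProductBilin (v.adicCompletion F) (v.adicCompletion F) (m := Fin 1))))
    (hg' : g' = symplecticConj (gramProd (localGram F 1 t v) (UnitaryGroup.isUnit_det_map (algebraMap F (v.adicCompletion F)) htd))
        (polar_dotProductBilin_gramProd (localGram F 1 t v) (UnitaryGroup.isUnit_det_map (algebraMap F (v.adicCompletion F)) htd))
        (iota F E c 1 hcδ hδ hd t ht hJ₁ v g)) (x : Fin 1 → v.adicCompletion F) :
    blockB (g' : ((Fin 1 → v.adicCompletion F) × (Fin 1 → v.adicCompletion F)) ≃ₗ[v.adicCompletion F]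
          ((Fin 1 → v.adicCompletion F) × (Fin 1 → v.adicCompletion F))) x =
        ((d : v.adicCompletion F) *
            QuadraticCoordinates.im (quadraticLocalEquiv E v c hcδ hδ).toLinearEquiv.toAddEquiv
              (fun w : PlacesOver E v => ((g : LocalGLPi E 1 v) w).val 0 0) *
          (localGram F 1 t v 0 0)⁻¹) • x ∧
      blockA (g' : ((Fin 1 → v.adicCompletion F) × (Fin 1 → v.adicCompletion F)) ≃ₗ[v.adicCompletion F]
          ((Fin 1 → v.adicCompletion F) × (Fin 1 → v.adicCompletion F))) x =
        QuadraticCoordinates.re (quadraticLocalEquiv E v c hcδ hδ).toLinearEquiv.toAddEquiv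
          (fun w : PlacesOver E v => ((g : LocalGLPi E 1 v) w).val 0 0) • x ∧
      blockD (g' : ((Fin 1 → v.adicCompletion F) × (Fin 1 → v.adicCompletion F)) ≃ₗ[v.adicCompletion F]
          ((Fin 1 → v.adicCompletion F) × (Fin 1 → v.adicCompletion F))) x =
        QuadraticCoordinates.re (quadraticLocalEquiv E v c hcδ hδ).toLinearEquiv.toAddEquiv
          (fun w : PlacesOver E v => ((g : LocalGLPi E 1 v) w).val 0 0) • x := by
  subst hg'
  refine ⟨?_, ?_, ?_⟩
  · rw [blockB_apply, rankOne_conj_iota_apply E c hcδ hδ hd t ht htd hJ₁ v g 0 x]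
    funext i
    simp only [Pi.zero_apply, mul_zero, zero_add, Pi.smul_apply, smul_eq_mul]
  · rw [blockA_apply, rankOne_conj_iota_apply E c hcδ hδ hd t ht htd hJ₁ v g x 0]
    funext i
    simp only [Pi.zero_apply, mul_zero, add_zero, Pi.smul_apply, smul_eq_mul]
  · rw [blockD_apply, rankOne_conj_iota_apply E c hcδ hδ hd t ht htd hJ₁ v g 0 x]
    funext i
    simp only [Pi.zero_apply, mul_zero, zero_add, Pi.smul_apply, smul_eq_mul]

omit [NumberField F] in
/-- a non-zero scalar acts bijectively on `F^1`. [folklore] -/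
private theorem bijective_of_eq_smul {K : Type*} [Field K] {s : K} (hs : s ≠ 0) {f : (Fin 1 → K) →ₗ[K] (Fin 1 → K)}
    (hf : ∀ x, f x = s • x) : Function.Bijective f := by
  refine ⟨fun x y hxy => ?_, fun y => ⟨s⁻¹ • y, ?_⟩⟩
  · rw [hf, hf] at hxy
    exact smul_right_injective _ hs hxy
  · rw [hf, smul_smul, mul_inv_cancel₀ hs, one_smul]

/-- **`g'` lies in Weil's big cell as soon as `d b τ⁻¹ ≠ 0`** (i.e. `b ≠ 0`): its `B`-block is invertible.
[cite: Weil1964, n° 7, p. 152] -/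
theorem rankOne_blockB_bijective (g : localPi E c 1 J₁ v)
    (g' : symplecticGroup (polar (dotProductBilin (v.adicCompletion F) (v.adicCompletion F) (m := Fin 1))))
    (hg' : g' = symplecticConj (gramProd (localGram F 1 t v) (UnitaryGroup.isUnit_det_map (algebraMap F (v.adicCompletion F)) htd))
        (polar_dotProductBilin_gramProd (localGram F 1 t v) (UnitaryGroup.isUnit_det_map (algebraMap F (v.adicCompletion F)) htd))
        (iota F E c 1 hcδ hδ hd t ht hJ₁ v g))
    (hβ : (d : v.adicCompletion F) *
          QuadraticCoordinates.im (quadraticLocalEquiv E v c hcδ hδ).toLinearEquiv.toAddEquiv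
            (fun w : PlacesOver E v => ((g : LocalGLPi E 1 v) w).val 0 0) *
        (localGram F 1 t v 0 0)⁻¹ ≠ 0) :
    Function.Bijective (blockB (g' : ((Fin 1 → v.adicCompletion F) × (Fin 1 → v.adicCompletion F)) ≃ₗ[v.adicCompletion F]
      ((Fin 1 → v.adicCompletion F) × (Fin 1 → v.adicCompletion F)))) :=
  bijective_of_eq_smul hβ fun x => (rankOne_conj_blocks E c hcδ hδ hd t ht htd hJ₁ v g g' hg' x).1

/-- **the cells of `g'` at rank one**: `B⁻¹ x = β⁻¹ x`, `γ x = (a β⁻¹) x`, `δ x = (β⁻¹ a) x` with `β = d b τ⁻¹`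
(`γ = D B⁻¹`, `δ = B⁻¹ A`). [cite: Weil1964, n° 7, Prop. 1, p. 152] -/
theorem rankOne_cells (g : localPi E c 1 J₁ v)
    (g' : symplecticGroup (polar (dotProductBilin (v.adicCompletion F) (v.adicCompletion F) (m := Fin 1))))
    (hg' : g' = symplecticConj (gramProd (localGram F 1 t v) (UnitaryGroup.isUnit_det_map (algebraMap F (v.adicCompletion F)) htd))
        (polar_dotProductBilin_gramProd (localGram F 1 t v) (UnitaryGroup.isUnit_det_map (algebraMap F (v.adicCompletion F)) htd))
        (iota F E c 1 hcδ hδ hd t ht hJ₁ v g))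
    (hβ : (d : v.adicCompletion F) *
          QuadraticCoordinates.im (quadraticLocalEquiv E v c hcδ hδ).toLinearEquiv.toAddEquiv
            (fun w : PlacesOver E v => ((g : LocalGLPi E 1 v) w).val 0 0) *
        (localGram F 1 t v 0 0)⁻¹ ≠ 0)
    (hB : Function.Bijective (blockB (g' : ((Fin 1 → v.adicCompletion F) × (Fin 1 → v.adicCompletion F)) ≃ₗ[v.adicCompletion F]
      ((Fin 1 → v.adicCompletion F) × (Fin 1 → v.adicCompletion F))))) (x : Fin 1 → v.adicCompletion F) :
    (cellB (g' : ((Fin 1 → v.adicCompletion F) × (Fin 1 → v.adicCompletion F)) ≃ₗ[v.adicCompletion F]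
          ((Fin 1 → v.adicCompletion F) × (Fin 1 → v.adicCompletion F))) hB).symm x =
        ((d : v.adicCompletion F) *
            QuadraticCoordinates.im (quadraticLocalEquiv E v c hcδ hδ).toLinearEquiv.toAddEquiv
              (fun w : PlacesOver E v => ((g : LocalGLPi E 1 v) w).val 0 0) *
          (localGram F 1 t v 0 0)⁻¹)⁻¹ • x ∧
      cellGamma (g' : ((Fin 1 → v.adicCompletion F) × (Fin 1 → v.adicCompletion F)) ≃ₗ[v.adicCompletion F]
          ((Fin 1 → v.adicCompletion F) × (Fin 1 → v.adicCompletion F))) hB x =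
        (QuadraticCoordinates.re (quadraticLocalEquiv E v c hcδ hδ).toLinearEquiv.toAddEquiv
            (fun w : PlacesOver E v => ((g : LocalGLPi E 1 v) w).val 0 0) *
          ((d : v.adicCompletion F) *
              QuadraticCoordinates.im (quadraticLocalEquiv E v c hcδ hδ).toLinearEquiv.toAddEquiv
                (fun w : PlacesOver E v => ((g : LocalGLPi E 1 v) w).val 0 0) *
            (localGram F 1 t v 0 0)⁻¹)⁻¹) • x ∧
      cellDelta (g' : ((Fin 1 → v.adicCompletion F) × (Fin 1 → v.adicCompletion F)) ≃ₗ[v.adicCompletion F]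
          ((Fin 1 → v.adicCompletion F) × (Fin 1 → v.adicCompletion F))) hB x =
        (((d : v.adicCompletion F) *
              QuadraticCoordinates.im (quadraticLocalEquiv E v c hcδ hδ).toLinearEquiv.toAddEquiv
                (fun w : PlacesOver E v => ((g : LocalGLPi E 1 v) w).val 0 0) *
            (localGram F 1 t v 0 0)⁻¹)⁻¹ *
          QuadraticCoordinates.re (quadraticLocalEquiv E v c hcδ hδ).toLinearEquiv.toAddEquiv
            (fun w : PlacesOver E v => ((g : LocalGLPi E 1 v) w).val 0 0)) • x := by
  have hblk := rankOne_conj_blocks E c hcδ hδ hd t ht htd hJ₁ v g g' hg'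
  have hsymm : ∀ y : Fin 1 → v.adicCompletion F,
      (cellB (g' : ((Fin 1 → v.adicCompletion F) × (Fin 1 → v.adicCompletion F)) ≃ₗ[v.adicCompletion F]
          ((Fin 1 → v.adicCompletion F) × (Fin 1 → v.adicCompletion F))) hB).symm y =
        ((d : v.adicCompletion F) *
            QuadraticCoordinates.im (quadraticLocalEquiv E v c hcδ hδ).toLinearEquiv.toAddEquiv
              (fun w : PlacesOver E v => ((g : LocalGLPi E 1 v) w).val 0 0) *
          (localGram F 1 t v 0 0)⁻¹)⁻¹ • y := by
    intro y
    have h := blockB_cellB_symm_apply (g' : ((Fin 1 → v.adicCompletion F) × (Fin 1 → v.adicCompletion F))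
      ≃ₗ[v.adicCompletion F] ((Fin 1 → v.adicCompletion F) × (Fin 1 → v.adicCompletion F))) hB y
    rw [(hblk _).1] at h
    exact ((inv_smul_eq_iff₀ hβ).2 h.symm).symm
  refine ⟨hsymm x, ?_, ?_⟩
  · rw [cellGamma_apply, hsymm, map_smul, (hblk _).2.2, smul_smul, mul_comm]
  · rw [cellDelta_apply, (hblk _).2.1, map_smul, hsymm, smul_smul, mul_comm]

end Cells


section Phase

variable {F : Type} [Field F] [NumberField F] (E : Type) [Field E] [NumberField E] [Algebra F E]
  [Algebra.IsQuadraticExtension F E] (c : E ≃ₐ[F] E) {δ : E} (hcδ : c δ = -δ) (hδ : δ ≠ 0) {d : F}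
  (hd : δ * δ = algebraMap F E d) (t : Matrix (Fin 1) (Fin 1) F) (ht : t.IsSymm) (htd : IsUnit t.det)
  {J₁ : Matrix (Fin 1) (Fin 1) E} (hJ₁ : J₁ = t.map (algebraMap F E)) (v : HeightOneSpectrum (𝓞 F))

/-- **the diagonal phase of the big-cell kernel at rank one**: `⟨x, B⁻¹x⟩ - ½⟨x, γx⟩ - ½⟨x, δx⟩ = β⁻¹(1 - a) x₀²`,
`β = d b τ⁻¹` (the quadratic form whose Gauss integral is the finite-level trace).
[cite: Weil1964, n° 13 (29), p. 160] -/
theorem rankOne_word_phase (g : localPi E c 1 J₁ v)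
    (g' : symplecticGroup (polar (dotProductBilin (v.adicCompletion F) (v.adicCompletion F) (m := Fin 1))))
    (hg' : g' = symplecticConj (gramProd (localGram F 1 t v) (UnitaryGroup.isUnit_det_map (algebraMap F (v.adicCompletion F)) htd))
        (polar_dotProductBilin_gramProd (localGram F 1 t v) (UnitaryGroup.isUnit_det_map (algebraMap F (v.adicCompletion F)) htd))
        (iota F E c 1 hcδ hδ hd t ht hJ₁ v g))
    (hβ : (d : v.adicCompletion F) *
          QuadraticCoordinates.im (quadraticLocalEquiv E v c hcδ hδ).toLinearEquiv.toAddEquiv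
            (fun w : PlacesOver E v => ((g : LocalGLPi E 1 v) w).val 0 0) *
        (localGram F 1 t v 0 0)⁻¹ ≠ 0)
    (hB : Function.Bijective (blockB (g' : ((Fin 1 → v.adicCompletion F) × (Fin 1 → v.adicCompletion F)) ≃ₗ[v.adicCompletion F]
      ((Fin 1 → v.adicCompletion F) × (Fin 1 → v.adicCompletion F))))) (x : Fin 1 → v.adicCompletion F) :
    x ⬝ᵥ (cellB (g' : ((Fin 1 → v.adicCompletion F) × (Fin 1 → v.adicCompletion F)) ≃ₗ[v.adicCompletion F]
          ((Fin 1 → v.adicCompletion F) × (Fin 1 → v.adicCompletion F))) hB).symm x -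
        halfForm (cellGamma (g' : ((Fin 1 → v.adicCompletion F) × (Fin 1 → v.adicCompletion F)) ≃ₗ[v.adicCompletion F]
          ((Fin 1 → v.adicCompletion F) × (Fin 1 → v.adicCompletion F))) hB) x -
        halfForm (cellDelta (g' : ((Fin 1 → v.adicCompletion F) × (Fin 1 → v.adicCompletion F)) ≃ₗ[v.adicCompletion F]
          ((Fin 1 → v.adicCompletion F) × (Fin 1 → v.adicCompletion F))) hB) x =
      ((d : v.adicCompletion F) *
            QuadraticCoordinates.im (quadraticLocalEquiv E v c hcδ hδ).toLinearEquiv.toAddEquiv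
              (fun w : PlacesOver E v => ((g : LocalGLPi E 1 v) w).val 0 0) *
          (localGram F 1 t v 0 0)⁻¹)⁻¹ *
        (1 - QuadraticCoordinates.re (quadraticLocalEquiv E v c hcδ hδ).toLinearEquiv.toAddEquiv
          (fun w : PlacesOver E v => ((g : LocalGLPi E 1 v) w).val 0 0)) * x 0 ^ 2 := by
  obtain ⟨h1, h2, h3⟩ := rankOne_cells E c hcδ hδ hd t ht htd hJ₁ v g g' hg' hβ hB x
  rw [halfForm_apply, halfForm_apply, h1, h2, h3, dotProduct_smul, dotProduct_smul, dotProduct_smul, invOf_eq_inv]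
  have hx : x ⬝ᵥ x = x 0 ^ 2 := by
    simp [dotProduct, sq]
  rw [hx, smul_eq_mul, smul_eq_mul, smul_eq_mul]
  have h2ne : (2 : v.adicCompletion F) ≠ 0 := two_ne_zero
  field_simp
  ring

omit [NumberField F] in
/-- **the box Gauss integral at rank one**: `∫_{(𝔭ⁿ)^1} ψ(A x₀²) dμ^⊗1 = g(A x², 𝔭ⁿ)` (Fubini over one factor).
[cite: Weil1964, Chap. II n° 27, p. 175] -/
theorem setIntegral_primePowPiBox_fin_one_psiSq {K : Type*} [Field K] [ValuativeRel K] [TopologicalSpace K]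
    [IsNonarchimedeanLocalField K] [MeasurableSpace K] [BorelSpace K] (μ : Measure K) [μ.IsAddHaarMeasure]
    (ψ : AddChar K Circle) (A : K) (n : ℤ) :
    ∫ x in primePowPiBox K (Fin 1) n, ((ψ (A * x 0 ^ 2) : Circle) : ℂ) ∂(Measure.pi fun _ : Fin 1 => μ) =
      gaussBall ψ μ A n := by
  have h := gaussPi_primePowPiBox (ψ := ψ) μ (fun _ : Fin 1 => A) n
  rw [Fin.prod_univ_one, gaussPi_def] at h
  rw [← h]
  refine setIntegral_congr_fun (measurableSet_primePowPiBox n) fun x _ => ?_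
  rw [psiSqPi_apply, Fin.sum_univ_one]

end Phase


/-! ## §5 Small tools: box shifts, zpow bounds, open subgroups of the compact torus, continuity of the coordinates -/

section Tools

/-- any bound is below some `q^{-e}` (`e ≤ 0` large negative). [folklore] -/
private theorem exists_le_inv_residueFieldCard_zpow {K : Type*} [Field K] [ValuativeRel K] [TopologicalSpace K]
    [IsNonarchimedeanLocalField K] (C : ℝ≥0) : ∃ e : ℤ, C ≤ ((residueFieldCard K : ℝ≥0)⁻¹) ^ e := by
  have hq : (1 : ℝ≥0) < (residueFieldCard K : ℝ≥0) := by exact_mod_cast one_lt_residueFieldCard K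
  obtain ⟨n, hn⟩ := pow_unbounded_of_one_lt C hq
  refine ⟨-(n : ℤ), ?_⟩
  rw [_root_.zpow_neg, zpow_natCast, inv_pow, inv_inv]
  exact hn.le

/-- **box shift by a bounded scalar**: `|s| ≤ q^{-e}` and `x ∈ (𝔭^a)^ι` give `s x ∈ (𝔭^{a+e})^ι`. [cite: Weil1964, Chap. II n° 27, p. 175] -/
theorem smul_mem_primePowPiBox_of_normAbs_le {K : Type*} [Field K] [ValuativeRel K] [TopologicalSpace K]
    [IsNonarchimedeanLocalField K] {ι : Type*} {s : K} {e : ℤ} (hs : normAbs K s ≤ ((residueFieldCard K : ℝ≥0)⁻¹) ^ e)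
    {a : ℤ} {x : ι → K} (hx : x ∈ primePowPiBox K ι a) : s • x ∈ primePowPiBox K ι (a + e) := by
  rw [mem_primePowPiBox_iff] at hx ⊢
  intro i
  rw [mem_primePowBall_iff, Pi.smul_apply, smul_eq_mul, map_mul, add_comm, zpow_add₀ (ne_of_gt inv_residueFieldCard_pos)]
  exact mul_le_mul' hs ((mem_primePowBall_iff).1 (hx i))

variable {F : Type} [Field F] [NumberField F] (E : Type) [Field E] [NumberField E] [Algebra F E]
  [Algebra.IsQuadraticExtension F E] (c : E ≃ₐ[F] E) {δ : E} (hcδ : c δ = -δ) (hδ : δ ≠ 0) {d : F}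
  (hd : δ * δ = algebraMap F E d) (t : Matrix (Fin 1) (Fin 1) F) (ht : t.IsSymm) (htd : IsUnit t.det)
  {J₁ : Matrix (Fin 1) (Fin 1) E} (hJ₁ : J₁ = t.map (algebraMap F E)) (v : HeightOneSpectrum (𝓞 F))
  (hE : IsField (UnitaryGroup.LocalRing E v))

include hcδ hδ htd hJ₁ hE in
/-- **open subgroups form a basis of neighbourhoods of `1` in `U(J₁)(F_v)`** at a non-split place (the torus is
compact and totally disconnected, hence profinite). [cite: PlatonovRapinchuk1994, §6.2] -/
theorem rankOne_exists_openSubgroup_subset {O : Set (localPi E c 1 J₁ v)} (hO : O ∈ 𝓝 (1 : localPi E c 1 J₁ v)) :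
    ∃ K₀ : Subgroup (localPi E c 1 J₁ v), IsOpen (K₀ : Set (localPi E c 1 J₁ v)) ∧ (K₀ : Set (localPi E c 1 J₁ v)) ⊆ O := by
  have hJ₁' : J₁ 0 0 ≠ 0 := by
    rw [hJ₁, Matrix.map_apply, map_ne_zero_iff _ (algebraMap F E).injective, ← Matrix.det_fin_one t]
    exact htd.ne_zero
  have hc : c ≠ 1 := by
    rintro rfl
    exact hδ (self_eq_neg.1 (by simpa only [AlgEquiv.one_apply] using hcδ))
  obtain ⟨w⟩ := (inferInstance : Nonempty (PlacesOver E v))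
  have hw : c • w.1 = w.1 := smul_placesOver_eq_of_isField F E c v hE w
  haveI : CompactSpace (localPi E c 1 J₁ v) := compactSpace_localPi_rankOne F E c hcδ hδ htd hJ₁ v hE
  haveI : TotallyDisconnectedSpace (localPi E c 1 J₁ v) := totallyDisconnectedSpace_localPi_one_of_smul_eq c J₁ hc hJ₁' w hw
  obtain ⟨U, hUO, hUo, h1U⟩ := mem_nhds_iff.1 hO
  obtain ⟨W, hWc, h1W, hWU⟩ := compact_exists_isClopen_in_isOpen hUo h1U
  obtain ⟨H, hH⟩ := IsTopologicalGroup.exist_openSubgroup_sub_clopen_nhds_of_one hWc h1W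
  exact ⟨(H : Subgroup (localPi E c 1 J₁ v)), H.isOpen, hH.trans (hWU.trans hUO)⟩

/-- the coordinate maps `k ↦ a(z₀ k)`, `k ↦ b(z₀ k)` (real and `δ`-parts of the scalar of `z₀ k`) are continuous.
[cite: PlatonovRapinchuk1994, §6.2] -/
theorem rankOne_continuous_coords (z₀ : localPi E c 1 J₁ v) :
    (Continuous fun k : localPi E c 1 J₁ v =>
        QuadraticCoordinates.re (quadraticLocalEquiv E v c hcδ hδ).toLinearEquiv.toAddEquiv
          (fun w : PlacesOver E v => (((z₀ * k : localPi E c 1 J₁ v) : LocalGLPi E 1 v) w).val 0 0)) ∧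
      Continuous fun k : localPi E c 1 J₁ v =>
        QuadraticCoordinates.im (quadraticLocalEquiv E v c hcδ hδ).toLinearEquiv.toAddEquiv
          (fun w : PlacesOver E v => (((z₀ * k : localPi E c 1 J₁ v) : LocalGLPi E 1 v) w).val 0 0) := by
  have hsc := (rankOne_continuous_scalar E c J₁ v).comp (continuous_const_mul z₀)
  have hΨ : Continuous ⇑(quadraticLocalEquiv E v c hcδ hδ).toLinearEquiv.toAddEquiv.symm :=
    (quadraticLocalEquiv E v c hcδ hδ).symm.continuous
  exact ⟨(QuadraticCoordinates.continuous_re _ hΨ).comp hsc, (QuadraticCoordinates.continuous_im _ hΨ).comp hsc⟩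

end Tools


/-! ## §6 The big-cell data of one torus element (small-term packaging of §3–§4) -/

section Data

variable (F : Type) [Field F] [NumberField F] (E : Type) [Field E] [NumberField E] [Algebra F E]
  [Algebra.IsQuadraticExtension F E] (c : E ≃ₐ[F] E) {δ : E} (hcδ : c δ = -δ) (hδ : δ ≠ 0) {d : F}
  (hd : δ * δ = algebraMap F E d) (t : Matrix (Fin 1) (Fin 1) F) (ht : t.IsSymm) (htd : IsUnit t.det)
  {J₁ : Matrix (Fin 1) (Fin 1) E} (hJ₁ : J₁ = t.map (algebraMap F E)) (v : HeightOneSpectrum (𝓞 F))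
  [MeasurableSpace (v.adicCompletion F)] [BorelSpace (v.adicCompletion F)]
  (μ : Measure (v.adicCompletion F)) [μ.IsAddHaarMeasure] {m : ℤ} (hm : (adeleAddCharAt F v).HasConductorExp m)
  (s₁ : localPi E c 1 J₁ v →* LocalMp F 1 t v)
  (hs₁ : ∀ g, MpPsi.proj _ (s₁ g) = iota F E c 1 hcδ hδ hd t ht hJ₁ v g)

include htd hs₁ in
/-- **the big-cell data of `g ∈ U(J₁)(F_v)` off `±1`**: for `ζ_g = a + b δ` with `b ≠ 0` there are `B, γ, δ'` and
`λ ≠ 0` with `ω_{s₁}(g) = λ · r(n(γ)) r(m(B)) r(w) r(n(δ'))`, `B⁻¹ = β⁻¹`, `γ = a β⁻¹`, `δ' = β⁻¹ a` (`β = d b τ⁻¹`),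
and diagonal phase `β⁻¹(1 - a) x₀²`. [cite: Weil1964, n° 13 (29), p. 160; MoeglinVignerasWaldspurger1987, Chap. 2 II.1 (A)] -/
theorem rankOne_bigCell_data (g : localPi E c 1 J₁ v) (a b : v.adicCompletion F)
    (ha : a = QuadraticCoordinates.re (quadraticLocalEquiv E v c hcδ hδ).toLinearEquiv.toAddEquiv
      (fun w : PlacesOver E v => ((g : LocalGLPi E 1 v) w).val 0 0))
    (hb : b = QuadraticCoordinates.im (quadraticLocalEquiv E v c hcδ hδ).toLinearEquiv.toAddEquiv
      (fun w : PlacesOver E v => ((g : LocalGLPi E 1 v) w).val 0 0))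
    (hβ : (d : v.adicCompletion F) * b * (localGram F 1 t v 0 0)⁻¹ ≠ 0) :
    ∃ (B : (Fin 1 → v.adicCompletion F) ≃ₗ[v.adicCompletion F] (Fin 1 → v.adicCompletion F))
      (γ δ' : (Fin 1 → v.adicCompletion F) →ₗ[v.adicCompletion F] (Fin 1 → v.adicCompletion F)) (cst : ℂ),
      cst ≠ 0 ∧
      (∀ f : SchwartzBruhat (Fin 1 → v.adicCompletion F),
        ((MpPsi.toRep (localSchrodinger F 1 t v)).comp s₁) g f =
          cst • ((unipOpPi (isLocallyConstant_of_isContinuousNontrivial (isContinuousNontrivial_adeleAddCharAt F v)) γ *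
              leviOpPi B * fourierOpPi (ι := Fin 1) μ (isContinuousNontrivial_adeleAddCharAt F v) hm *
              unipOpPi (isLocallyConstant_of_isContinuousNontrivial (isContinuousNontrivial_adeleAddCharAt F v)) δ' :
            SchwartzBruhat (Fin 1 → v.adicCompletion F) ≃ₗ[ℂ] SchwartzBruhat (Fin 1 → v.adicCompletion F)) f)) ∧
      (∀ x : Fin 1 → v.adicCompletion F,
        B.symm x = ((d : v.adicCompletion F) * b * (localGram F 1 t v 0 0)⁻¹)⁻¹ • x ∧
          γ x = (a * ((d : v.adicCompletion F) * b * (localGram F 1 t v 0 0)⁻¹)⁻¹) • x ∧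
          δ' x = (((d : v.adicCompletion F) * b * (localGram F 1 t v 0 0)⁻¹)⁻¹ * a) • x) ∧
      (∀ x : Fin 1 → v.adicCompletion F,
        x ⬝ᵥ B.symm x - halfForm γ x - halfForm δ' x =
          ((d : v.adicCompletion F) * b * (localGram F 1 t v 0 0)⁻¹)⁻¹ * (1 - a) * x 0 ^ 2) := by
  subst ha hb
  have hB := rankOne_blockB_bijective E c hcδ hδ hd t ht htd hJ₁ v g _ rfl hβ
  obtain ⟨lam, hlam⟩ := rankOne_exists_scalar_bigCellWord F E c hcδ hδ hd t ht htd hJ₁ v μ hm s₁ hs₁ g _ rfl hB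
  exact ⟨_, _, _, (lam : ℂ), lam.ne_zero, hlam, fun x => rankOne_cells E c hcδ hδ hd t ht htd hJ₁ v g _ rfl hβ hB x,
    fun x => rankOne_word_phase E c hcδ hδ hd t ht htd hJ₁ v g _ rfl hβ hB x⟩

end Data


/-! ## §7 THE PACKAGE (H1): an open subgroup `K₀` on which `ω_{s₁}(z₀ k)` is a constant multiple of a big-cell family
with one Gauss value and one box shift -/

section Package

variable (F : Type) [Field F] [NumberField F] (E : Type) [Field E] [NumberField E] [Algebra F E]
  [Algebra.IsQuadraticExtension F E] (c : E ≃ₐ[F] E) (δ : E) (hcδ : c δ = -δ) (hδ : δ ≠ 0) (d : F)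
  (hd : δ * δ = algebraMap F E d) (t : Matrix (Fin 1) (Fin 1) F) (ht : t.IsSymm) (htd : IsUnit t.det)
  (J₁ : Matrix (Fin 1) (Fin 1) E) (hJ₁ : J₁ = t.map (algebraMap F E)) (v : HeightOneSpectrum (𝓞 F))
  (hE : IsField (UnitaryGroup.LocalRing E v))
  (s₁ : localPi E c 1 J₁ v →* LocalMp F 1 t v)
  (hs₁ : ∀ g, MpPsi.proj _ (s₁ g) = iota F E c 1 hcδ hδ hd t ht hJ₁ v g)
  (hsm₁ : Representation.IsSmooth ((MpPsi.toRep (localSchrodinger F 1 t v)).comp s₁))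

-- one long assembly proof (coordinates, neighbourhood, open subgroup, test vector, Gauss value, box shifts, all in a
-- 25-binder context): about 3× the default budget.
set_option maxHeartbeats 800000 in
include htd ht hJ₁ hE hs₁ hsm₁ in
/-- **H1 — the torus big-cell package.**  For the rank `1 × 1` oscillator representation `ω_{s₁}` of the compact torus
`U(J₁)(F_v) = E_v¹` at a non-split place and `z₀` with `z₀² ≠ 1` (so `ι_v(z₀)` lies in Weil's big cell), there is an
open subgroup `K₀` and, for `k ∈ K₀`, Weil cells `γ_k, δ_k, B_k` on `F_v^1`, ONE constant `c ≠ 0`, ONE Gauss value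
`Gv ≠ 0`, a stable depth `m₀` and a box shift `e₀`, such that: (W1) `ω_{s₁}(z₀ k) = (c |det B_k|^{1/2}) · r(n(γ_k)) r(m(B_k))
r(w) r(n(δ_k))`; (W2) the Gauss integral of the diagonal phase `⟨x, B_k⁻¹x⟩ - ½⟨x,γ_k x⟩ - ½⟨x, δ_k x⟩` over every box
`(𝔭ⁿ)^1`, `n ≤ m₀`, is `Gv`; (W3) `γ_k`, `B_k⁻¹`, `δ_k` shift every box by at most `e₀`.  (The hypotheses of B-p04's
`trace_restrict_fixed_eq_of_bigCell_family`, H2, at `ι = Fin 1`.)  Proof: §1–§6, the coordinates of `z₀ k` vary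
continuously, open subgroups are a basis at `1` (profinite torus), the scalar `λ_{z₀k}|det B_k|^{-1/2}` is read off the
test vector `𝟙_{𝔭^{n₁}}` (`exists_const_word`), and the Gauss value is Weil's stable value at nearby coefficients
(`gaussBall_eq_weilGauss_of_sub_mem_of_lt`).
[cite: Weil1964, n° 13 (29) p. 160, Chap. II n° 27 p. 175; MoeglinVignerasWaldspurger1987, Chap. 2 II.1 (A)] -/
theorem rankOne_torus_bigCell_package (z₀ : localPi E c 1 J₁ v) (hz₀ : z₀ * z₀ ≠ 1)
    [MeasurableSpace (v.adicCompletion F)] [BorelSpace (v.adicCompletion F)]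
    (μ : Measure (v.adicCompletion F)) [μ.IsAddHaarMeasure] (m : ℤ) (hm : (adeleAddCharAt F v).HasConductorExp m) :
    ∃ K₀ : Subgroup (localPi E c 1 J₁ v), IsOpen (K₀ : Set (localPi E c 1 J₁ v)) ∧
      ∃ (γ_ δ_ : localPi E c 1 J₁ v →
          ((Fin 1 → v.adicCompletion F) →ₗ[v.adicCompletion F] (Fin 1 → v.adicCompletion F)))
        (B_ : localPi E c 1 J₁ v →
          ((Fin 1 → v.adicCompletion F) ≃ₗ[v.adicCompletion F] (Fin 1 → v.adicCompletion F)))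
        (cc Gv : ℂ) (m₀ e₀ : ℤ), cc ≠ 0 ∧ Gv ≠ 0 ∧
        (∀ k ∈ K₀, ∀ f : SchwartzBruhat (Fin 1 → v.adicCompletion F),
          ((MpPsi.toRep (localSchrodinger F 1 t v)).comp s₁) (z₀ * k) f =
            (cc * (modSqrt (B_ k) : ℂ)) •
              ((unipOpPi (isLocallyConstant_of_isContinuousNontrivial (isContinuousNontrivial_adeleAddCharAt F v)) (γ_ k) *
                  leviOpPi (B_ k) * fourierOpPi μ (isContinuousNontrivial_adeleAddCharAt F v) hm *
                  unipOpPi (isLocallyConstant_of_isContinuousNontrivial (isContinuousNontrivial_adeleAddCharAt F v)) (δ_ k) :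
                SchwartzBruhat (Fin 1 → v.adicCompletion F) ≃ₗ[ℂ] SchwartzBruhat (Fin 1 → v.adicCompletion F)) f)) ∧
        (∀ k ∈ K₀, ∀ n ≤ m₀,
          ∫ x in primePowPiBox (v.adicCompletion F) (Fin 1) n,
            ((adeleAddCharAt F v (x ⬝ᵥ (B_ k).symm x - halfForm (γ_ k) x - halfForm (δ_ k) x) : Circle) : ℂ)
              ∂(Measure.pi fun _ : Fin 1 => μ) = Gv) ∧
        (∀ k ∈ K₀, ∀ (a : ℤ) (x : Fin 1 → v.adicCompletion F), x ∈ primePowPiBox (v.adicCompletion F) (Fin 1) a →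
          γ_ k x ∈ primePowPiBox (v.adicCompletion F) (Fin 1) (a - e₀) ∧
            (B_ k).symm x ∈ primePowPiBox (v.adicCompletion F) (Fin 1) (a - e₀) ∧
            δ_ k x ∈ primePowPiBox (v.adicCompletion F) (Fin 1) (a - e₀)) := by
  classical
  haveI : SecondCountableTopology (v.adicCompletion F) := secondCountableTopology_localField (v.adicCompletion F)
  -- ### notation and basic non-vanishing facts
  have hψ := isContinuousNontrivial_adeleAddCharAt F v
  have hq := isQuadraticCoordinates_local E v c hcδ hδ hd
  have hJ₁' : J₁ 0 0 ≠ 0 := by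
    rw [hJ₁, Matrix.map_apply, map_ne_zero_iff _ (algebraMap F E).injective, ← Matrix.det_fin_one t]
    exact htd.ne_zero
  have hτ0 : localGram F 1 t v 0 0 ≠ 0 := localGram_entry_ne_zero t htd v
  have hd0 : (d : v.adicCompletion F) ≠ 0 := by
    intro h0
    have hδδ := hq.mul_self
    rw [h0, map_zero] at hδδ
    letI := hE.toField
    have hδ0 : algebraMap E (LocalRing E v) δ = 0 := mul_self_eq_zero.1 hδδ
    have h1 := hq.im_delta
    rw [hδ0, map_zero] at h1
    exact zero_ne_one h1
  -- the coordinate functions of `z₀ k`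
  obtain ⟨aOf, haOf⟩ : ∃ f : localPi E c 1 J₁ v → v.adicCompletion F, ∀ k, f k =
      QuadraticCoordinates.re (quadraticLocalEquiv E v c hcδ hδ).toLinearEquiv.toAddEquiv
        (fun w : PlacesOver E v => (((z₀ * k : localPi E c 1 J₁ v) : LocalGLPi E 1 v) w).val 0 0) := ⟨_, fun _ => rfl⟩
  obtain ⟨bOf, hbOf⟩ : ∃ f : localPi E c 1 J₁ v → v.adicCompletion F, ∀ k, f k =
      QuadraticCoordinates.im (quadraticLocalEquiv E v c hcδ hδ).toLinearEquiv.toAddEquiv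
        (fun w : PlacesOver E v => (((z₀ * k : localPi E c 1 J₁ v) : LocalGLPi E 1 v) w).val 0 0) := ⟨_, fun _ => rfl⟩
  have ha_cont : Continuous aOf := by
    rw [show aOf = _ from funext haOf]; exact (rankOne_continuous_coords E c hcδ hδ v z₀).1
  have hb_cont : Continuous bOf := by
    rw [show bOf = _ from funext hbOf]; exact (rankOne_continuous_coords E c hcδ hδ v z₀).2
  -- `β k = d b(z₀k) τ⁻¹`, `A k = β_k⁻¹ (1 - a(z₀k))` (as opaque functions with their equations)
  obtain ⟨β, hβ⟩ : ∃ f : localPi E c 1 J₁ v → v.adicCompletion F, ∀ k, f k =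
      (d : v.adicCompletion F) * bOf k * (localGram F 1 t v 0 0)⁻¹ := ⟨_, fun _ => rfl⟩
  obtain ⟨A, hA⟩ : ∃ f : localPi E c 1 J₁ v → v.adicCompletion F, ∀ k, f k = (β k)⁻¹ * (1 - aOf k) :=
    ⟨_, fun _ => rfl⟩
  -- at `k = 1`: `b₀ ≠ 0`, `a₀ ≠ 1`
  have hb1 : bOf 1 ≠ 0 := by
    rw [hbOf 1, mul_one]
    exact rankOne_im_ne_zero_of_mul_self_ne_one E c J₁ v hJ₁' hcδ hδ hd z₀ hz₀
  have hβ1 : β 1 ≠ 0 := by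
    rw [hβ 1]; exact mul_ne_zero (mul_ne_zero hd0 hb1) (inv_ne_zero hτ0)
  have ha1 : 1 - aOf 1 ≠ 0 := by
    intro h
    have hsq := rankOne_re_sq_sub E c J₁ v hJ₁' hcδ hδ hd (z₀ * 1)
    rw [← haOf 1, ← hbOf 1, show aOf 1 = 1 from (sub_eq_zero.1 h).symm, one_pow, sub_eq_self, mul_eq_zero] at hsq
    rcases hsq with h0 | h0
    · exact hd0 h0
    · exact hb1 (pow_eq_zero_iff two_ne_zero |>.1 h0)
  have hA1 : A 1 ≠ 0 := by
    rw [hA 1]; exact mul_ne_zero (inv_ne_zero hβ1) ha1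
  -- ### the Gauss constants
  obtain ⟨vA, hvA⟩ := exists_normAbs_eq_inv_zpow hA1
  obtain ⟨v₂, hv₂⟩ := exists_normAbs_eq_inv_zpow (two_ne_zero : (2 : v.adicCompletion F) ≠ 0)
  set m₀ : ℤ := min (m - vA - 2 * v₂) 0 with hm₀
  have hm₀' : 2 * m₀ ≤ m - vA - 2 * v₂ := by
    rcases le_total (m - vA - 2 * v₂) 0 with h | h
    · rw [hm₀, min_eq_left h]; omega
    · rw [hm₀, min_eq_right h]; omega
  have hGv : weilGauss (adeleAddCharAt F v) μ (A 1) ≠ 0 := weilGauss_ne_zero μ hψ hA1 two_ne_zero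
  -- ### the box-shift constant
  obtain ⟨C, hC⟩ : ∃ C : ℝ≥0, C = max (normAbs (v.adicCompletion F) (β 1)⁻¹) (normAbs (v.adicCompletion F) (A 1)) :=
    ⟨_, rfl⟩
  obtain ⟨e, he⟩ := exists_le_inv_residueFieldCard_zpow (K := v.adicCompletion F) C
  obtain ⟨n₁, hn₁'⟩ : ∃ n₁ : ℤ, m ≤ -v₂ + e + 2 * n₁ := ⟨max 0 (m + v₂ - e), by
    rcases le_total 0 (m + v₂ - e) with h | h
    · rw [max_eq_right h]; omega
    · rw [max_eq_left h]; omega⟩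
  -- ### the neighbourhood of `1` and the open subgroup `K₀`
  have hcn := LocalFieldHaar.continuous_normAbs (F := v.adicCompletion F)
  have hA_cont : ContinuousAt A 1 := by
    have hβf : β = fun k => (d : v.adicCompletion F) * bOf k * (localGram F 1 t v 0 0)⁻¹ := funext hβ
    have hAf : A = fun k => (β k)⁻¹ * (1 - aOf k) := funext hA
    have h1 : ContinuousAt β 1 := by
      rw [hβf]; exact ((continuous_const.mul hb_cont).mul continuous_const).continuousAt
    rw [hAf]
    exact (h1.inv₀ hβ1).mul (continuous_const.sub ha_cont).continuousAt
  -- the neighbourhood `O` of `1`: `|b_k - b₀| < |b₀|`, `|A_k - A₀| < |A₀|`, `A_k - A₀ ∈ 𝔭^{m-2m₀}`, `k` fixes `𝟙_{𝔭^{n₁}}`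
  have hO : (bOf ⁻¹' {y : v.adicCompletion F |
        normAbs (v.adicCompletion F) (y - bOf 1) < normAbs (v.adicCompletion F) (bOf 1)} ∩
      A ⁻¹' ({y : v.adicCompletion F | normAbs (v.adicCompletion F) (y - A 1) < normAbs (v.adicCompletion F) (A 1)} ∩
        (fun y : v.adicCompletion F => y - A 1) ⁻¹' primePowBall (v.adicCompletion F) (m - 2 * m₀)) ∩
      (Representation.stabilizerSubgroup ((MpPsi.toRep (localSchrodinger F 1 t v)).comp s₁)
        (piBallSB (v.adicCompletion F) (Fin 1) n₁) : Set (localPi E c 1 J₁ v))) ∈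
      𝓝 (1 : localPi E c 1 J₁ v) := by
    refine Filter.inter_mem (Filter.inter_mem ?_ (hA_cont.preimage_mem_nhds ?_)) ?_
    · refine ((isOpen_lt (hcn.comp (continuous_id.sub continuous_const)) continuous_const).preimage hb_cont).mem_nhds ?_
      show normAbs (v.adicCompletion F) (bOf 1 - bOf 1) < normAbs (v.adicCompletion F) (bOf 1)
      rw [sub_self, map_zero]
      exact normAbs_units_pos (Units.mk0 _ hb1)
    · refine IsOpen.mem_nhds ?_ ⟨?_, ?_⟩
      · exact (isOpen_lt (hcn.comp (continuous_id.sub continuous_const)) continuous_const).inter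
          ((isOpen_primePowBall _).preimage (continuous_id.sub continuous_const))
      · show normAbs (v.adicCompletion F) (A 1 - A 1) < normAbs (v.adicCompletion F) (A 1)
        rw [sub_self, map_zero]
        exact normAbs_units_pos (Units.mk0 _ hA1)
      · show A 1 - A 1 ∈ primePowBall (v.adicCompletion F) (m - 2 * m₀)
        rw [sub_self]
        exact zero_mem_primePowBall _
    · refine (hsm₁ _).mem_nhds ?_
      rw [SetLike.mem_coe, Representation.mem_stabilizerSubgroup, map_one]
      rfl
  obtain ⟨K₀, hK₀o, hK₀O⟩ := rankOne_exists_openSubgroup_subset E c hcδ hδ t htd hJ₁ v hE hO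
  -- facts valid on `K₀`
  have hK : ∀ k ∈ K₀, normAbs (v.adicCompletion F) (bOf k) = normAbs (v.adicCompletion F) (bOf 1) ∧
      (normAbs (v.adicCompletion F) (A k - A 1) < normAbs (v.adicCompletion F) (A 1) ∧
        A k - A 1 ∈ primePowBall (v.adicCompletion F) (m - 2 * m₀)) ∧
      ((MpPsi.toRep (localSchrodinger F 1 t v)).comp s₁) k (piBallSB (v.adicCompletion F) (Fin 1) n₁) = piBallSB (v.adicCompletion F) (Fin 1) n₁ := by
    intro k hk
    obtain ⟨⟨h1, h2⟩, h3⟩ := hK₀O hk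
    change normAbs (v.adicCompletion F) (bOf k - bOf 1) < normAbs (v.adicCompletion F) (bOf 1) at h1
    change normAbs (v.adicCompletion F) (A k - A 1) < normAbs (v.adicCompletion F) (A 1) ∧
      A k - A 1 ∈ primePowBall (v.adicCompletion F) (m - 2 * m₀) at h2
    refine ⟨?_, h2, h3⟩
    have := LocalFieldHaar.normAbs_add_eq_of_lt h1
    rwa [add_sub_cancel] at this
  have hbk : ∀ k ∈ K₀, bOf k ≠ 0 := fun k hk h0 => by
    have := (hK k hk).1
    rw [h0, map_zero] at this
    exact (normAbs_units_pos (Units.mk0 _ hb1)).ne this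
  have hβk : ∀ k ∈ K₀, β k ≠ 0 := fun k hk => by
    rw [hβ k]; exact mul_ne_zero (mul_ne_zero hd0 (hbk k hk)) (inv_ne_zero hτ0)
  have hβnorm : ∀ k ∈ K₀, normAbs (v.adicCompletion F) (β k)⁻¹ = normAbs (v.adicCompletion F) (β 1)⁻¹ := by
    intro k hk
    rw [hβ k, hβ 1, map_inv₀, map_inv₀, map_mul, map_mul, map_mul, map_mul, (hK k hk).1]
  have hAnorm : ∀ k ∈ K₀, normAbs (v.adicCompletion F) (A k) = normAbs (v.adicCompletion F) (A 1) := by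
    intro k hk
    have h := (hK k hk).2.1.1
    rw [← normAbs_neg, neg_sub] at h
    exact Literature.NumberTheory.Weil1964.normAbs_eq_of_normAbs_sub_lt h
  -- the scalar `s_k = β_k⁻¹ a_k = β_k⁻¹ - A_k` is bounded by `C`
  have hsC : ∀ k ∈ K₀, normAbs (v.adicCompletion F) ((β k)⁻¹ * aOf k) ≤ C := by
    intro k hk
    have e1 : (β k)⁻¹ * aOf k = (β k)⁻¹ + -A k := by rw [hA k]; ring
    rw [e1, hC]
    refine (normAbs_add_le_max _ _).trans ?_
    rw [normAbs_neg, hβnorm k hk, hAnorm k hk]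
  have hβC : ∀ k ∈ K₀, normAbs (v.adicCompletion F) (β k)⁻¹ ≤ C := fun k hk => by
    rw [hβnorm k hk, hC]; exact le_max_left _ _
  have hq0 : (0 : ℝ≥0) < (residueFieldCard (v.adicCompletion F) : ℝ≥0)⁻¹ := inv_residueFieldCard_pos
  have hq1 : (residueFieldCard (v.adicCompletion F) : ℝ≥0)⁻¹ ≤ 1 := inv_residueFieldCard_lt_one.le
  -- ### the big-cell data along `z₀ K₀` (§6), chosen as functions of `k`
  have key : ∀ k : localPi E c 1 J₁ v, ∃ (B : (Fin 1 → v.adicCompletion F) ≃ₗ[v.adicCompletion F]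
      (Fin 1 → v.adicCompletion F)) (γ δ' : (Fin 1 → v.adicCompletion F) →ₗ[v.adicCompletion F]
      (Fin 1 → v.adicCompletion F)) (cst : ℂ), β k ≠ 0 →
      cst ≠ 0 ∧
      (∀ f : SchwartzBruhat (Fin 1 → v.adicCompletion F), ((MpPsi.toRep (localSchrodinger F 1 t v)).comp s₁) (z₀ * k) f =
          cst • ((unipOpPi (isLocallyConstant_of_isContinuousNontrivial hψ) γ * leviOpPi B *
              fourierOpPi (ι := Fin 1) μ hψ hm * unipOpPi (isLocallyConstant_of_isContinuousNontrivial hψ) δ' :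
            SchwartzBruhat (Fin 1 → v.adicCompletion F) ≃ₗ[ℂ] SchwartzBruhat (Fin 1 → v.adicCompletion F)) f)) ∧
      (∀ x : Fin 1 → v.adicCompletion F,
        B.symm x = (β k)⁻¹ • x ∧ γ x = (aOf k * (β k)⁻¹) • x ∧ δ' x = ((β k)⁻¹ * aOf k) • x) ∧
      (∀ x : Fin 1 → v.adicCompletion F,
        x ⬝ᵥ B.symm x - halfForm γ x - halfForm δ' x = A k * x 0 ^ 2) := by
    intro k
    by_cases hk : β k ≠ 0
    · have hk' : (d : v.adicCompletion F) * bOf k * (localGram F 1 t v 0 0)⁻¹ ≠ 0 := by rw [← hβ k]; exact hk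
      obtain ⟨B, γ, δ', cst, h1, h2, h3, h4⟩ := rankOne_bigCell_data F E c hcδ hδ hd t ht htd hJ₁ v μ hm s₁ hs₁
        (z₀ * k) (aOf k) (bOf k) (haOf k) (hbOf k) hk'
      refine ⟨B, γ, δ', cst, fun _ => ⟨h1, h2, fun x => ?_, fun x => ?_⟩⟩
      · rw [hβ k]; exact h3 x
      · rw [hA k, hβ k]; exact h4 x
    · exact ⟨LinearEquiv.refl _ _, 0, 0, 0, fun h => absurd h hk⟩
  choose B_ γ_ δ_ cst hkey using key
  -- ### (W1): the constant, via the test vector `𝟙_{(𝔭^{n₁})^1}`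
  have hword : ∀ k ∈ K₀, ∀ f : SchwartzBruhat (Fin 1 → v.adicCompletion F), ((MpPsi.toRep (localSchrodinger F 1 t v)).comp s₁) (z₀ * k) f =
      cst k • ((unipOpPi (isLocallyConstant_of_isContinuousNontrivial hψ) (γ_ k) * leviOpPi (B_ k) *
          fourierOpPi (ι := Fin 1) μ hψ hm * unipOpPi (isLocallyConstant_of_isContinuousNontrivial hψ) (δ_ k) :
        SchwartzBruhat (Fin 1 → v.adicCompletion F) ≃ₗ[ℂ] SchwartzBruhat (Fin 1 → v.adicCompletion F)) f) :=
    fun k hk => ((hkey k) (hβk k hk)).2.1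
  have hfix : ∀ k ∈ K₀, ((MpPsi.toRep (localSchrodinger F 1 t v)).comp s₁) k (piBallSB (v.adicCompletion F) (Fin 1) n₁) = piBallSB (v.adicCompletion F) (Fin 1) n₁ :=
    fun k hk => (hK k hk).2.2
  have hδφ : ∀ k ∈ K₀, ∀ x ∈ piPrimePowBall (v.adicCompletion F) (Fin 1) n₁,
      halfForm (δ_ k) x ∈ primePowBall (v.adicCompletion F) m := by
    intro k hk x hx
    rw [halfForm_apply, ((hkey k (hβk k hk)).2.2.1 x).2.2, dotProduct_smul, smul_eq_mul, invOf_eq_inv,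
      mem_primePowBall_iff, map_mul, map_mul, map_inv₀, hv₂]
    have hx0 : normAbs (v.adicCompletion F) (x 0) ≤ (residueFieldCard (v.adicCompletion F) : ℝ≥0)⁻¹ ^ n₁ :=
      (mem_primePowBall_iff).1 ((mem_piPrimePowBall_iff).1 hx 0)
    have hxx : normAbs (v.adicCompletion F) (x ⬝ᵥ x) ≤ (residueFieldCard (v.adicCompletion F) : ℝ≥0)⁻¹ ^ (2 * n₁) := by
      have e1 : x ⬝ᵥ x = x 0 * x 0 := by simp [dotProduct]
      rw [e1, map_mul, two_mul, zpow_add₀ hq0.ne']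
      exact mul_le_mul' hx0 hx0
    calc ((residueFieldCard (v.adicCompletion F) : ℝ≥0)⁻¹ ^ v₂)⁻¹ *
          (normAbs (v.adicCompletion F) ((β k)⁻¹ * aOf k) * normAbs (v.adicCompletion F) (x ⬝ᵥ x))
        ≤ (residueFieldCard (v.adicCompletion F) : ℝ≥0)⁻¹ ^ (-v₂) *
          ((residueFieldCard (v.adicCompletion F) : ℝ≥0)⁻¹ ^ e *
            (residueFieldCard (v.adicCompletion F) : ℝ≥0)⁻¹ ^ (2 * n₁)) := by
          rw [_root_.zpow_neg]
          exact mul_le_mul' le_rfl (mul_le_mul' ((hsC k hk).trans he) hxx)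
      _ = (residueFieldCard (v.adicCompletion F) : ℝ≥0)⁻¹ ^ (-v₂ + e + 2 * n₁) := by
          rw [zpow_add₀ hq0.ne', zpow_add₀ hq0.ne', mul_assoc]
      _ ≤ (residueFieldCard (v.adicCompletion F) : ℝ≥0)⁻¹ ^ m := zpow_le_zpow_right_of_le_one₀ hq0 hq1 hn₁'
  obtain ⟨c₀, hc₀⟩ := exists_const_word (isLocallyConstant_of_isContinuousNontrivial hψ) μ hψ hm ((MpPsi.toRep (localSchrodinger F 1 t v)).comp s₁) K₀ z₀ γ_ δ_ B_ cst n₁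
    hword hfix hδφ
  have hc₀ne : c₀ ≠ 0 := by
    intro h0
    have h1 := hc₀ 1 K₀.one_mem (piBallSB (v.adicCompletion F) (Fin 1) n₁)
    rw [h0, zero_mul, zero_smul] at h1
    have h2 := hword 1 K₀.one_mem (piBallSB (v.adicCompletion F) (Fin 1) n₁)
    rw [h1] at h2
    have h3 := congrArg (fun f : SchwartzBruhat (Fin 1 → v.adicCompletion F) => (f : (Fin 1 → v.adicCompletion F) → ℂ) 0) h2
    simp only [Submodule.coe_zero, Pi.zero_apply, Submodule.coe_smul, Pi.smul_apply, smul_eq_mul] at h3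
    rw [word_piBallSB_apply_zero (isLocallyConstant_of_isContinuousNontrivial hψ) μ hψ hm (γ_ 1) (δ_ 1) (B_ 1) n₁
      (hδφ 1 K₀.one_mem)] at h3
    refine (mul_ne_zero ((hkey 1 hβ1).1) (mul_ne_zero (inv_ne_zero ?_) ?_)) h3.symm
    · exact Complex.ofReal_ne_zero.2 (modSqrt_pos _).ne'
    · exact Complex.ofReal_ne_zero.2 (measureReal_piPrimePowBall_pos (Measure.pi fun _ : Fin 1 => μ) n₁).ne'
  -- ### assemble
  refine ⟨K₀, hK₀o, γ_, δ_, B_, c₀, weilGauss (adeleAddCharAt F v) μ (A 1), m₀, -e, hc₀ne, hGv, hc₀, ?_, ?_⟩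
  · -- (W2) the common Gauss value
    intro k hk n hn
    have hph := (hkey k (hβk k hk)).2.2.2
    calc ∫ x in primePowPiBox (v.adicCompletion F) (Fin 1) n,
          ((adeleAddCharAt F v (x ⬝ᵥ (B_ k).symm x - halfForm (γ_ k) x - halfForm (δ_ k) x) : Circle) : ℂ)
            ∂(Measure.pi fun _ : Fin 1 => μ)
        = ∫ x in primePowPiBox (v.adicCompletion F) (Fin 1) n,
            ((adeleAddCharAt F v (A k * x 0 ^ 2) : Circle) : ℂ) ∂(Measure.pi fun _ : Fin 1 => μ) :=
          setIntegral_congr_fun (measurableSet_primePowPiBox n) fun x _ => by rw [hph x]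
      _ = gaussBall (adeleAddCharAt F v) μ (A k) n := setIntegral_primePowPiBox_fin_one_psiSq μ _ _ n
      _ = weilGauss (adeleAddCharAt F v) μ (A 1) := by
          refine Literature.NumberTheory.Weil1964.gaussBall_eq_weilGauss_of_sub_mem_of_lt μ hm hvA ?_ hv₂ hm₀' ?_ hn
          · have h := (hK k hk).2.1.1
            rwa [← normAbs_neg, neg_sub] at h
          · have h := neg_mem_primePowBall (hK k hk).2.1.2
            rwa [neg_sub] at h
  · -- (W3) the box shift
    intro k hk a x hx
    obtain ⟨h1, h2, h3⟩ := (hkey k (hβk k hk)).2.2.1 x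
    rw [h1, h2, h3, sub_neg_eq_add]
    refine ⟨smul_mem_primePowPiBox_of_normAbs_le ?_ hx, smul_mem_primePowPiBox_of_normAbs_le ((hβC k hk).trans he) hx,
      smul_mem_primePowPiBox_of_normAbs_le ((hsC k hk).trans he) hx⟩
    rw [mul_comm]
    exact (hsC k hk).trans he

end Package


end Literature.RepresentationTheory.MoeglinVignerasWaldspurger1987

end
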